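import Summits.ABC.IUTFork.Cor312PilotKummerCompatNonVacuity
import Summits.ABC.IUTFork.Cor312PilotIdelesPrCapstone
import Summits.ABC.IUTFork.Thm311Real3
import HarnessLib

/-!
# Branch C — STATUS OF THE v3/v4 ANTECEDENT (hull-level line S_H): what a «non-vacuity witness at honest data» would be

PROOF-ONLY record (0 definitions, 0 `Prop` facts) by abc-iut-C-cert-1, answering C-lead ruling C-R10c (2026-08-26T07:26:50Z: «S_H-line v3:
non-vacuity witness at honest data — wanted: C-cert-1/aud») and concurring with abc-iut-C-cert-2's correction F2 (07:44:10Z). TAKES NO SIDE on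
[IUTchIII] Cor. 3.12; statements about OUR typed objects; typed ≠ proved; instantiated ≠ endorsed.

The v3/v4 certificates (`Conditional/AbcOfSGenuine.lean` p430884 `abc_of_S_v3`; `Conditional/AbcOfSGenuineRegime.lean` `abc_of_S_v4`) assume,
per genuine Θ-volume datum, the bundle «∃ setting data ρ qK …, `Cor312Vol.QPinned` ∧ `Cor312Vol.PilotKummerCompatHull` ∧ …» at abc-iut-c312-7's
print-normalised assembled real setting `Real.settingPrVolSharp`. THIS FILE records, in the kernel:

1. `exists_qPinned_and_hull_iff` — for ANY typed situation/setting: «∃ ρ qK, QPinned ∧ PilotKummerCompatHull» ⟺ «at EVERY label `j` and place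
   `v_ℚ` the q-pilot region lies in the Θ-hull» (`∀ j vQ, P.qRegion j vQ ⊆ P.thetaHull j vQ`; the (xi-f) `Licence` at all labels). The q-pin
   alone carries no constraint (ρ := the constant reading `qRegion`); the whole content of the bundle is the hull INCLUSION.
2. `statement_of_exists_qPinned_and_hull` — with `BridgeHyps`, such a witness yields the typed `Cor312.Setting.Statement`
   (`statement_of_pilotKummerCompatHull`).
3. **`thetaSide_of_exists_qPinned_and_hull_settingPrVolSharp`** — AT THE GENUINE SETTING with q-ideles realising `P_q` and Θ-ideles units
   off `S` (where `BridgeHyps`/`ThetaFinite` are theorems and `Statement ↔ ↑(−deĝ(P_q)) ≤ −|log Θ|`, c312-7 `statement_settingPrVolSharp_iff`):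
   a witness of the v3/v4 antecedent IS A KERNEL PROOF OF THE Θ-SIDE INEQUALITY OF THE TYPED COROLLARY 3.12 at that setting — the cell's
   adjudication question itself («NOT asserted and NOT denied», `Cor312PilotIdelesPrCapstone`). Contrapositive
   `not_exists_qPinned_and_hull_of_not_thetaSide`. HENCE: the «non-vacuity witness at honest data» of C-R10c cannot be supplied by a
   certificate seat without deciding (P) at the real setting; conversely any kernel refutation of the typed Corollary there (as in the sharp
   toy models of record: abc-iut-w4-d101 `pinnedSetting_not_licence`, abc-iut-w5-d247/w5-d068 `honestQ_not_pilotKummerCompatHull`) refutes the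
   bundle. The status of the S_H antecedent at honest genuine data is therefore EXACTLY «open = the adjudication inequality», neither
   «non-vacuous» nor «refuted» in the kernel today; at interface level it is satisfiable (item 4).
4. `SH_bundle_satisfiable_interface` — the interface-level witness (analogue of `Conditional/AbcOfSNonVacuity.lean` p428146 for the S_H line):
   at abc-iut-w5-d247's link-identified pinned setting P♭ over `naiveFull 2` the group «QPinned ∧ PilotKummerCompatHull ∧ BridgeHyps ∧ |log q| > 0»
   holds and the Statement follows (abc-iut-w5-d068 `pilotKummerCompat_hypotheses_satisfiable`, re-packaged to the v3 binder shape).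
[claim: Mochizuki2012, status: disputed] [cite: ScholzeStix2018, §2.2 pp. 9–10] [cite: DupuyHilado2025, §3.3–§3.4, Thm. 3.10.1]
-/

noncomputable section

open Set Function NumberField IsDedekindDomain

namespace Summit.ABC.IUTFork.Conditional.Antecedent

open Thm311 Thm311.Real Cor312 Cor312Vol Literature.IUT.LogThetaLattice Literature.IUT.LogVolume Literature.IUT.HodgeTheaters

/-! ## 1–2. The bundle «∃ ρ qK, QPinned ∧ PilotKummerCompatHull» is the hull inclusion at every label -/

section General

variable {T : ThetaIndex} (S : LatticeSituation T) (P : Cor312.Setting S.toSituation)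

/-- **The v3/v4 per-datum IUT-side bundle, unbundled**: there are a region reading `ρ` and a q-datum `qK` with the q-pin and the hull-level
printed clause iff the q-pilot region lies in the Θ-hull `ⁿ˒°𝒰_{j,v_ℚ}` at EVERY `(j, v_ℚ)` (the (xi-f) licence at all labels). The q-pin alone is
free (constant reading). [claim: Mochizuki2012, status: disputed] -/
theorem exists_qPinned_and_hull_iff :
    (∃ (ρ : (∀ v : T.V, v ∈ T.Vbad → Set (S.L.StarPacket v)) → ∀ (j : T.Label) (vQ : T.VQ), Set (S.L.Packet j vQ))
        (qK : ∀ v : T.V, v ∈ T.Vbad → Set (S.L.StarPacket v)),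
        Cor312Vol.QPinned S P ρ qK ∧ Cor312Vol.PilotKummerCompatHull S P ρ qK) ↔
      ∀ (j : T.Label) (vQ : T.VQ), P.qRegion j vQ ⊆ P.thetaHull j vQ := by
  constructor
  · rintro ⟨ρ, qK, hq, hh⟩ j vQ
    rw [hq j vQ]
    exact hh j vQ
  · intro h
    exact ⟨fun _ j vQ => P.qRegion j vQ, fun _ _ => ∅, fun _ _ => rfl, fun j vQ => h j vQ⟩

/-- With the bridge hypotheses, a witness of the bundle yields the typed Statement of Cor. 3.12 for the setting
(abc-iut-w5-d068 `statement_of_pilotKummerCompatHull`). [claim: Mochizuki2012, status: disputed] -/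
theorem statement_of_exists_qPinned_and_hull (H : Cor312Vol.BridgeHyps P)
    (h : ∃ (ρ : (∀ v : T.V, v ∈ T.Vbad → Set (S.L.StarPacket v)) → ∀ (j : T.Label) (vQ : T.VQ), Set (S.L.Packet j vQ))
        (qK : ∀ v : T.V, v ∈ T.Vbad → Set (S.L.StarPacket v)),
        Cor312Vol.QPinned S P ρ qK ∧ Cor312Vol.PilotKummerCompatHull S P ρ qK) :
    P.Statement := by
  obtain ⟨ρ, qK, hq, hh⟩ := h
  exact statement_of_pilotKummerCompatHull S P ρ qK H hq hh

/-- Contrapositive: where the typed Statement fails, the bundle has NO witness. [claim: Mochizuki2012, status: disputed] -/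
theorem not_exists_qPinned_and_hull_of_not_statement (H : Cor312Vol.BridgeHyps P) (hns : ¬ P.Statement) :
    ¬ ∃ (ρ : (∀ v : T.V, v ∈ T.Vbad → Set (S.L.StarPacket v)) → ∀ (j : T.Label) (vQ : T.VQ), Set (S.L.Packet j vQ))
        (qK : ∀ v : T.V, v ∈ T.Vbad → Set (S.L.StarPacket v)),
        Cor312Vol.QPinned S P ρ qK ∧ Cor312Vol.PilotKummerCompatHull S P ρ qK :=
  fun h => hns (statement_of_exists_qPinned_and_hull S P H h)

end General

/-! ## 3. At the genuine print-normalised real setting: a witness = the Θ-side inequality of the typed Corollary -/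

section Genuine

variable {F : Type} [Field F] [NumberField F] (X : PilotData F) {logv : PadicLogs F} (hlog : LogvAnalytic logv)
  (M : Type) [Field M] [NumberField M]
  (archPk : ∀ (j : (thetaIndex X).Label) (vQ : (thetaIndex X).VQ), Set ((logShellsDH X logv).Packet j vQ))
  (archSub : ∀ (j : (thetaIndex X).Label) (v : (thetaIndex X).V),
    Set ((logShellsDH X logv).Packet j ((thetaIndex X).over v)))
  (Ψ : ℤ → ∀ v : (thetaIndex X).V, v ∈ (thetaIndex X).Vbad → Set ((logShellsDH X logv).StarPacket v))
  (act : ℤ → ∀ v : (thetaIndex X).V, v ∈ (thetaIndex X).Vbad →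
    (logShellsDH X logv).StarPacket v → Module.End ℚ ((logShellsDH X logv).StarPacket v))
  (Mmod : ℤ → ∀ j : (thetaIndex X).LabelStar, Set ((logShellsDH X logv).GlobalPacket j.1))
  (region : ℤ → ∀ j : (thetaIndex X).LabelStar, FinDivisor M → ∀ vQ : (thetaIndex X).VQ,
    Set ((logShellsDH X logv).Packet j.1 vQ))
  (frobAdm : ℤ → ℤ → ∀ (j : (thetaIndex X).Label) (vQ : (thetaIndex X).VQ),
    Set ((logShellsDH X logv).Packet j vQ) → Prop)
  (frobLogvol : ℤ → ℤ → ∀ (j : (thetaIndex X).Label) (vQ : (thetaIndex X).VQ),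
    Set ((logShellsDH X logv).Packet j vQ) → ℝ)
  (frobΨ : ℤ → ℤ → ∀ v : (thetaIndex X).V, v ∈ (thetaIndex X).Vbad → Set ((logShellsDH X logv).StarPacket v))
  (frobMmod : ℤ → ℤ → ∀ j : (thetaIndex X).LabelStar, Set ((logShellsDH X logv).GlobalPacket j.1))
  (unitImage : ℤ → ℤ → ℕ → ∀ (j : (thetaIndex X).Label) (vQ : (thetaIndex X).VQ),
    Set ((logShellsDH X logv).Packet j vQ))
  (ballImage : ℤ → ℤ → ∀ (j : (thetaIndex X).Label) (vQ : (thetaIndex X).VQ),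
    Set ((logShellsDH X logv).Packet j vQ))
  (thetaDiv : ℤ → ℤ → LgpDivisor M (thetaIndex X).lstar)
  (n : ℤ) {HT : Type} {LogLink : HT → HT → Type} {IsFull : ∀ {s t : HT}, LogLink s t → Prop}
  (lat : LGPGaussianLogThetaLattice LogLink IsFull)
  {Frd : Type} {IsoF : Frd → Frd → Type} {Ob : Frd → Type} {realify : Frd → Frd} {Strip : Type}
  {IsoS : Strip → Strip → Type} {Mv : ∀ v : (thetaIndex X).V, v ∈ (thetaIndex X).Vbad → Type}
  [∀ v h, Monoid (Mv v h)]
  (sig : GlobalLGPFrobenioidSignature (thetaIndex X).lstar (thetaIndex X).V (· ∈ (thetaIndex X).Vbad)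
    Frd IsoF Ob realify Strip IsoS Mv)
  (split : SplittingMonoids Mv) {ObΔ : Type} {N : ∀ v : (thetaIndex X).V, v ∈ (thetaIndex X).Vbad → Type}
  [∀ v h, Monoid (N v h)] (qData : QPilotData ObΔ N)
  (t : ∀ (pp : Nat.Primes) (_ : Fin X.lstar) (x : (thetaIndex X).Fibre (.inr pp)),
    haveI : Fact (pp : ℕ).Prime := ⟨pp.2⟩; kOf X pp.1 x)
  (tq : ∀ (pp : Nat.Primes) (x : (thetaIndex X).Fibre (.inr pp)), haveI : Fact (pp : ℕ).Prime := ⟨pp.2⟩; kOf X pp.1 x)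

/-- **At the genuine setting, a «non-vacuity witness at honest data» of the v3/v4 antecedent IS a kernel proof of the Θ-side inequality of
the typed Corollary 3.12** (`↑(−deĝ(P_q)) ≤ −|log Θ|` at abc-iut-c312-7's `settingPrVolSharp`, its `statement_settingPrVolSharp_iff`): for
q-ideles REALISING `P_q` and Θ-ideles non-zero / units off `S`, any `ρ`, `qK` with `QPinned ∧ PilotKummerCompatHull` there give it. So the
witness C-R10c asks for is the adjudication inequality at the real setting — not a certificate-level object. [claim: Mochizuki2012, status: disputed] -/
theorem thetaSide_of_exists_qPinned_and_hull_settingPrVolSharp (ht0 : ∀ pp i x, t pp i x ≠ 0)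
    (ht1 : ∀ (pp : Nat.Primes) (i : Fin X.lstar) (x : (thetaIndex X).Fibre (.inr pp)),
      haveI : Fact (pp : ℕ).Prime := ⟨pp.2⟩; placeOf X pp.1 x ∉ X.S → ‖t pp i x‖ = 1)
    (htq0 : ∀ pp x, tq pp x ≠ 0)
    (htq1 : ∀ (pp : Nat.Primes) (x : (thetaIndex X).Fibre (.inr pp)),
      haveI : Fact (pp : ℕ).Prime := ⟨pp.2⟩; placeOf X pp.1 x ∉ X.S → ‖tq pp x‖ = 1)
    (htq : ∀ (pp : Nat.Primes) (x : (thetaIndex X).Fibre (.inr pp)),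
      haveI : Fact (pp : ℕ).Prime := ⟨pp.2⟩
      Real.log ‖tq pp x‖ = -(X.qPilot (placeOf X pp.1 x)) * logNorm F (placeOf X pp.1 x) /
        localDegree F (placeOf X pp.1 x))
    (h : ∃ (ρ : (∀ v : (thetaIndex X).V, v ∈ (thetaIndex X).Vbad → Set ((logShellsDH X logv).StarPacket v)) →
          ∀ (j : (thetaIndex X).Label) (vQ : (thetaIndex X).VQ), Set ((logShellsDH X logv).Packet j vQ))
        (qK : ∀ v : (thetaIndex X).V, v ∈ (thetaIndex X).Vbad → Set ((logShellsDH X logv).StarPacket v)),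
        Cor312Vol.QPinned
            (LatticeSituation.ofShells (logShellsDH X logv) M archPk archSub (summandPiecesPr X hlog).Adm
              (summandPiecesPr X hlog).logvol Ψ act Mmod region frobAdm frobLogvol frobΨ frobMmod unitImage ballImage thetaDiv)
            (settingPrVolSharp X hlog M archPk archSub Ψ act Mmod region n lat sig split qData tq t htq0 htq1) ρ qK ∧
          Cor312Vol.PilotKummerCompatHull
            (LatticeSituation.ofShells (logShellsDH X logv) M archPk archSub (summandPiecesPr X hlog).Adm
              (summandPiecesPr X hlog).logvol Ψ act Mmod region frobAdm frobLogvol frobΨ frobMmod unitImage ballImage thetaDiv)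
            (settingPrVolSharp X hlog M archPk archSub Ψ act Mmod region n lat sig split qData tq t htq0 htq1) ρ qK) :
    (((-FinDivisor.ndeg F X.qPilot : ℝ)) : WithTop ℝ) ≤
      (settingPrVolSharp X hlog M archPk archSub Ψ act Mmod region n lat sig split qData tq t htq0 htq1).negLogTheta :=
  (statement_settingPrVolSharp_iff X hlog M archPk archSub Ψ act Mmod region n lat sig split qData t tq ht0 ht1 htq0 htq1 htq).1
    (statement_of_exists_qPinned_and_hull
      (LatticeSituation.ofShells (logShellsDH X logv) M archPk archSub (summandPiecesPr X hlog).Adm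
        (summandPiecesPr X hlog).logvol Ψ act Mmod region frobAdm frobLogvol frobΨ frobMmod unitImage ballImage thetaDiv)
      (settingPrVolSharp X hlog M archPk archSub Ψ act Mmod region n lat sig split qData tq t htq0 htq1)
      (bridgeHyps_settingPrVolSharp_of_ideles X hlog M archPk archSub Ψ act Mmod region n lat sig split qData t tq ht0 ht1 htq0
        htq1)
      h)

/-- **Contrapositive at the genuine setting**: if the Θ-side inequality of the typed Corollary FAILS at `settingPrVolSharp` (realising
q-ideles), the v3/v4 antecedent has NO witness there, for any `ρ`, `qK`. [claim: Mochizuki2012, status: disputed] -/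
theorem not_exists_qPinned_and_hull_settingPrVolSharp_of_not_thetaSide (ht0 : ∀ pp i x, t pp i x ≠ 0)
    (ht1 : ∀ (pp : Nat.Primes) (i : Fin X.lstar) (x : (thetaIndex X).Fibre (.inr pp)),
      haveI : Fact (pp : ℕ).Prime := ⟨pp.2⟩; placeOf X pp.1 x ∉ X.S → ‖t pp i x‖ = 1)
    (htq0 : ∀ pp x, tq pp x ≠ 0)
    (htq1 : ∀ (pp : Nat.Primes) (x : (thetaIndex X).Fibre (.inr pp)),
      haveI : Fact (pp : ℕ).Prime := ⟨pp.2⟩; placeOf X pp.1 x ∉ X.S → ‖tq pp x‖ = 1)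
    (htq : ∀ (pp : Nat.Primes) (x : (thetaIndex X).Fibre (.inr pp)),
      haveI : Fact (pp : ℕ).Prime := ⟨pp.2⟩
      Real.log ‖tq pp x‖ = -(X.qPilot (placeOf X pp.1 x)) * logNorm F (placeOf X pp.1 x) /
        localDegree F (placeOf X pp.1 x))
    (hneg : ¬ (((-FinDivisor.ndeg F X.qPilot : ℝ)) : WithTop ℝ) ≤
      (settingPrVolSharp X hlog M archPk archSub Ψ act Mmod region n lat sig split qData tq t htq0 htq1).negLogTheta) :
    ¬ ∃ (ρ : (∀ v : (thetaIndex X).V, v ∈ (thetaIndex X).Vbad → Set ((logShellsDH X logv).StarPacket v)) →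
          ∀ (j : (thetaIndex X).Label) (vQ : (thetaIndex X).VQ), Set ((logShellsDH X logv).Packet j vQ))
        (qK : ∀ v : (thetaIndex X).V, v ∈ (thetaIndex X).Vbad → Set ((logShellsDH X logv).StarPacket v)),
        Cor312Vol.QPinned
            (LatticeSituation.ofShells (logShellsDH X logv) M archPk archSub (summandPiecesPr X hlog).Adm
              (summandPiecesPr X hlog).logvol Ψ act Mmod region frobAdm frobLogvol frobΨ frobMmod unitImage ballImage thetaDiv)
            (settingPrVolSharp X hlog M archPk archSub Ψ act Mmod region n lat sig split qData tq t htq0 htq1) ρ qK ∧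
          Cor312Vol.PilotKummerCompatHull
            (LatticeSituation.ofShells (logShellsDH X logv) M archPk archSub (summandPiecesPr X hlog).Adm
              (summandPiecesPr X hlog).logvol Ψ act Mmod region frobAdm frobLogvol frobΨ frobMmod unitImage ballImage thetaDiv)
            (settingPrVolSharp X hlog M archPk archSub Ψ act Mmod region n lat sig split qData tq t htq0 htq1) ρ qK :=
  fun h => hneg (thetaSide_of_exists_qPinned_and_hull_settingPrVolSharp X hlog M archPk archSub Ψ act Mmod region frobAdm frobLogvol
    frobΨ frobMmod unitImage ballImage thetaDiv n lat sig split qData t tq ht0 ht1 htq0 htq1 htq h)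

end Genuine

/-! ## 4. Interface-level witness of the S_H per-datum group (analogue of `AbcOfSNonVacuity.lean` for the v3 line) -/

open Cor312Vol.NaiveWitness Cor312Vol.GluedMonoids.Naive in
/-- **The S_H per-datum group is satisfiable at interface level**: at abc-iut-w5-d247's link-identified pinned setting P♭ over the contentful
typed-Thm-3.11 instance `naiveFull 2` (operator `ballOfMonoid`, datum `Ψ`), the q-pin, the hull-level printed clause, every bridge hypothesis
and `|log(q)| > 0` hold, and the typed Statement follows (abc-iut-w5-d068 lineage `linkId_pilotKummerCompatHull`, w5-d247 `linkId_pinnedRegions3`,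
`linkId_bridgeHyps`, `linkId_absLogQPos`). NOT an honest-data witness (the q-datum of P♭ is link-IDENTIFIED with the Θ-monoid); see §3 for why an
honest-data witness is the adjudication inequality itself. [claim: Mochizuki2012, status: disputed] -/
theorem SH_bundle_satisfiable_interface :
    ∃ (T : ThetaIndex) (S : LatticeSituation T) (P : Cor312.Setting S.toSituation)
      (ρ : (∀ v : T.V, v ∈ T.Vbad → Set (S.L.StarPacket v)) → ∀ (j : T.Label) (vQ : T.VQ), Set (S.L.Packet j vQ))
      (qK : ∀ v : T.V, v ∈ T.Vbad → Set (S.L.StarPacket v)),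
      Cor312Vol.QPinned S P ρ qK ∧ Cor312Vol.PilotKummerCompatHull S P ρ qK ∧ Cor312Vol.BridgeHyps P ∧ P.AbsLogQPos ∧ P.Statement := by
  haveI : Fact (Nat.Prime 2) := ⟨Nat.prime_two⟩
  exact ⟨_, (naiveFull 2).toLatticeSituation, linkIdSetting 2, ballOfMonoid 2, fun v _ => Psi 2 v,
    (linkId_pinnedRegions3 2).1.2, linkId_pilotKummerCompatHull 2, linkId_bridgeHyps 2, linkId_absLogQPos 2,
    (linkId_statement_attained 2).1⟩

end Summit.ABC.IUTFork.Conditional.Antecedent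

end
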